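import Mathlib.Tactic
import HarnessLib
import HarnessLib.Audit.Tags

/-!
# Purely inseparable four-folds — THE PURE-CORNER DRIFT: under the corner maps on two or three chart letters, every exponent
# trajectory is eventually ESCAPED (all axis sums `≥ p`); the combinatorial core of «no pure-corner tail on ≤ 3 chart letters»
# (cell `res-dim4-pi`, K2(p) lane, B rows; the `∀`-letters, weight-free, cone-free successor of the p-5 g3 window game
# `…ResConeCornerGame`)

[OURS · counted 0 · cell `res-dim4-pi` · K2(p) lane (holder res-dim4-p-12 g5; rung 0 (d) «is there a game for the frozen pure-corner regime of
the power cones at all») · seat res-dim4-p-5 g6.]  Nothing here proves any TAIL(p, d, e), K2(7), K2(p), `NoIsolatedTrap p p` or resolution of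
singularities in dimension ≥ 4 / characteristic `p` — NOT proved; this file is pure integer bookkeeping (no polynomial, no field).  AI kernel work,
weaker than expert review.

THE DYNAMICS.  Along a PURE-CORNER stretch (all chart points `b k = 0`) a monomial `x^E` of `F` moves alone: chart `i` replaces `E_i` by
`|E| − p` and keeps the other exponents.  Put `δ_l := (Σ_{m ≠ l} E_m) − p` (the order of `x^E` along the `x_l`-AXIS, minus `p`; the axis is NOT
`p`-fold at the state iff some present monomial has `δ_l ≤ −1`).  Then charting `i` FIXES `δ_i` and ADDS `δ_i` to every other `δ_l` — for every
letter `l`, chart letter or not.  On the chart letters this is a closed integer dynamics, and: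
* `pureCorner_drift_two` — TWO chart letters `a ≠ b`, each charted infinitely often, `δ` bounded below: from some time on `δ_a, δ_b ≥ 0`.
  Potential `δ_a δ_b` (it grows by `δ_{j}²` at a step charting `j`; it is `≤ −1` while the signs are mixed).
* `pureCorner_drift_three` — THREE chart letters, each charted infinitely often, `δ` bounded below: from some time on `δ_a, δ_b, δ_c ≥ 0`.
  Potential `(δ_a + δ_b + δ_c)² − 2(δ_a² + δ_b² + δ_c²)` (grows by `4 δ_j²`; `≤ −1` in every MIXED state — some `δ ≥ 1`, some `δ ≤ −1`); an
  all-nonpositive state with a negative entry («doom») drives the sum to `−∞`, against the lower bound; an all-nonnegative state is absorbing.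
With FOUR chart letters the form is indefinite on mixed states (not claimed).  Chain-level sequel: `…ResConePureCornerTail`.
[cite: CossartJannsenSaito2020, Lemma 13.2, Lemma 13.4, Thm. 13.7] [cite: Hauser2010, §§F–G (chart expressions of a point blowup)]
bears_on: LADDER-RESOLUTION:D157-DOOR2 (res-dim4-pi · K2(p) B rows · pure-corner drift).  Supports stmt-ResolutionOfSingularities-16155 (helper).
-/

set_option linter.dupNamespace false -- mandated namespace of this single-conjunct summit

namespace Summit.ResolutionOfSingularities.ResolutionOfSingularities.Theorems.PIDim4

namespace ResCone

/-! ## 1. Two chart letters -/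

/-- **PURE-CORNER DRIFT ON TWO LETTERS.**  A word `j` in two letters `a ≠ b`, each occurring beyond every time; integer data `δ t l` with
`δ (t+1) (j t) = δ t (j t)` and `δ (t+1) l = δ t l + δ t (j t)` for `l ≠ j t`; `δ t a, δ t b` bounded below.  Then from some time on
`δ t a ≥ 0` and `δ t b ≥ 0`. [OURS] [cite: CossartJannsenSaito2020, Lemma 13.4] -/
theorem pureCorner_drift_two {j : ℕ → Fin 4} {a b : Fin 4} (hab : a ≠ b) (hj : ∀ t, j t = a ∨ j t = b)
    (ha : ∀ T, ∃ t, T ≤ t ∧ j t = a) (hb : ∀ T, ∃ t, T ≤ t ∧ j t = b) {δ : ℕ → Fin 4 → ℤ}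
    (hfix : ∀ t, δ (t + 1) (j t) = δ t (j t)) (hadd : ∀ t l, l ≠ j t → δ (t + 1) l = δ t l + δ t (j t))
    {B : ℤ} (hB : ∀ t, B ≤ δ t a ∧ B ≤ δ t b) :
    ∃ T, ∀ t, T ≤ t → 0 ≤ δ t a ∧ 0 ≤ δ t b := by
  -- one-step formulas
  have step : ∀ t, (j t = a ∧ δ (t + 1) a = δ t a ∧ δ (t + 1) b = δ t b + δ t a) ∨
      (j t = b ∧ δ (t + 1) b = δ t b ∧ δ (t + 1) a = δ t a + δ t b) := by
    intro t
    rcases hj t with h | h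
    · left
      refine ⟨h, ?_, ?_⟩
      · have := hfix t; rwa [h] at this
      · have := hadd t b (by rw [h]; exact hab.symm); rwa [h] at this
    · right
      refine ⟨h, ?_, ?_⟩
      · have := hfix t; rwa [h] at this
      · have := hadd t a (by rw [h]; exact hab); rwa [h] at this
  -- the potential `δ a · δ b`
  have hpot : ∀ t, δ (t + 1) a * δ (t + 1) b = δ t a * δ t b + δ t (j t) ^ 2 := by
    intro t
    rcases step t with ⟨h, h1, h2⟩ | ⟨h, h1, h2⟩
    · rw [h1, h2, h]; ring
    · rw [h1, h2, h]; ring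
  have hmono : ∀ t T, t ≤ T → δ t a * δ t b ≤ δ T a * δ T b := by
    intro t T htT
    induction T, htT using Nat.le_induction with
    | base => exact le_refl _
    | succ T _ ih => exact ih.trans (by rw [hpot T]; nlinarith [sq_nonneg (δ T (j T))])
  -- escaped states are absorbing
  have hesc : ∀ t, 0 ≤ δ t a ∧ 0 ≤ δ t b → ∀ T, t ≤ T → 0 ≤ δ T a ∧ 0 ≤ δ T b := by
    intro t ht T htT
    induction T, htT using Nat.le_induction with
    | base => exact ht
    | succ T _ ih =>
      rcases step T with ⟨-, h1, h2⟩ | ⟨-, h1, h2⟩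
      · rw [h1, h2]; exact ⟨ih.1, add_nonneg ih.2 ih.1⟩
      · rw [h1, h2]; exact ⟨add_nonneg ih.1 ih.2, ih.2⟩
  by_cases hE : ∃ t, 0 ≤ δ t a ∧ 0 ≤ δ t b
  · obtain ⟨t, ht⟩ := hE
    exact ⟨t, hesc t ht⟩
  push Not at hE
  exfalso
  -- doomed states (both `≤ 0`, one `≤ −1`) drive the sum below the bound
  have hdoom_persist : ∀ t, δ t a ≤ 0 ∧ δ t b ≤ 0 → ∀ T, t ≤ T → δ T a ≤ δ t a ∧ δ T b ≤ δ t b := by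
    intro t ht T htT
    induction T, htT using Nat.le_induction with
    | base => exact ⟨le_refl _, le_refl _⟩
    | succ T _ ih =>
      rcases step T with ⟨-, h1, h2⟩ | ⟨-, h1, h2⟩
      · rw [h1, h2]; exact ⟨ih.1, by linarith [ih.1, ih.2, ht.1]⟩
      · rw [h1, h2]; exact ⟨by linarith [ih.1, ih.2, ht.2], ih.2⟩
  by_cases hD : ∃ t, δ t a ≤ 0 ∧ δ t b ≤ 0
  · obtain ⟨t₀, ht₀⟩ := hD
    -- one of them is `≤ −1` (not escaped)
    have hneg : δ t₀ a ≤ -1 ∨ δ t₀ b ≤ -1 := by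
      have h := hE t₀
      by_contra hc
      push Not at hc
      exact absurd (h (by omega)) (by omega)
    -- after the negative letter is charted, both are `≤ −1`
    obtain ⟨t₁, ht₁, hboth⟩ : ∃ t₁, t₀ ≤ t₁ ∧ δ t₁ a ≤ -1 ∧ δ t₁ b ≤ -1 := by
      rcases hneg with hna | hnb
      · obtain ⟨t, ht, hjt⟩ := ha t₀
        have hp := hdoom_persist t₀ ht₀ t ht
        rcases step t with ⟨-, h1, h2⟩ | ⟨h, -, -⟩
        · exact ⟨t + 1, by omega, by rw [h1]; linarith [hp.1], by rw [h2]; linarith [hp.1, hp.2, ht₀.2]⟩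
        · exact absurd (hjt.symm.trans h) hab
      · obtain ⟨t, ht, hjt⟩ := hb t₀
        have hp := hdoom_persist t₀ ht₀ t ht
        rcases step t with ⟨h, -, -⟩ | ⟨-, h1, h2⟩
        · exact absurd (hjt.symm.trans h) hab.symm
        · exact ⟨t + 1, by omega, by rw [h2]; linarith [hp.1, hp.2, ht₀.1], by rw [h1]; linarith [hp.2]⟩
    -- from `t₁` on the sum drops by at least `1` each step
    have hdrop : ∀ n : ℕ, δ (t₁ + n) a + δ (t₁ + n) b ≤ δ t₁ a + δ t₁ b - n ∧
        δ (t₁ + n) a ≤ -1 ∧ δ (t₁ + n) b ≤ -1 := by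
      intro n
      induction n with
      | zero => simpa using hboth
      | succ n ih =>
        rw [show t₁ + (n + 1) = t₁ + n + 1 by ring]
        rcases step (t₁ + n) with ⟨-, h1, h2⟩ | ⟨-, h1, h2⟩
        · rw [h1, h2]; push_cast; refine ⟨by linarith [ih.1, ih.2.1], ih.2.1, by linarith [ih.2.1, ih.2.2]⟩
        · rw [h1, h2]; push_cast; refine ⟨by linarith [ih.1, ih.2.2], by linarith [ih.2.1, ih.2.2], ih.2.2⟩
    obtain ⟨n, hn⟩ : ∃ n : ℕ, δ t₁ a + δ t₁ b - 2 * B < n :=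
      ⟨(δ t₁ a + δ t₁ b - 2 * B).natAbs + 1, by
        push_cast; linarith [le_abs_self (δ t₁ a + δ t₁ b - 2 * B)]⟩
    have h1 := (hdrop n).1
    have h2 := hB (t₁ + n)
    linarith [h2.1, h2.2]
  push Not at hD
  -- every state is MIXED: the potential is `≤ −1` for ever, yet it grows without bound
  have hmix : ∀ t, δ t a * δ t b ≤ -1 := by
    intro t
    have h1 := hE t
    have h2 := hD t
    by_cases ha0 : 0 ≤ δ t a
    · have hb1 : δ t b ≤ -1 := by have := h1 ha0; omega
      have ha1 : 1 ≤ δ t a := by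
        by_contra h
        exact absurd (h2 (by omega)) (by omega)
      nlinarith
    · have ha1 : δ t a ≤ -1 := by omega
      have hb1 : 1 ≤ δ t b := by
        by_contra h
        exact absurd (h2 (by omega)) (by omega)
      nlinarith
  -- non-zero charted values occur beyond every time (else the state freezes at an escaped one)
  have hnz : ∀ T, ∃ t, T ≤ t ∧ δ t (j t) ≠ 0 := by
    intro T
    by_contra hno
    push Not at hno
    have hconst : ∀ t, T ≤ t → δ t a = δ T a ∧ δ t b = δ T b := by
      intro t ht
      induction t, ht using Nat.le_induction with
      | base => exact ⟨rfl, rfl⟩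
      | succ t ht ih =>
        have h0 := hno t ht
        rcases step t with ⟨h, h1, h2⟩ | ⟨h, h1, h2⟩
        · have h0a : δ t a = 0 := by rw [← h]; exact h0
          exact ⟨by rw [h1]; exact ih.1, by rw [h2, h0a, add_zero]; exact ih.2⟩
        · have h0b : δ t b = 0 := by rw [← h]; exact h0
          exact ⟨by rw [h2, h0b, add_zero]; exact ih.1, by rw [h1]; exact ih.2⟩
    obtain ⟨ta, hta, hja⟩ := ha T
    obtain ⟨tb, htb, hjb⟩ := hb T
    have hza : δ T a = 0 := by rw [← (hconst ta hta).1, ← hja]; exact hno ta hta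
    have hzb : δ T b = 0 := by rw [← (hconst tb htb).2, ← hjb]; exact hno tb htb
    have h := hE T (by rw [hza])
    rw [hzb] at h
    exact lt_irrefl _ h
  have hgrow : ∀ n : ℕ, ∃ t, δ 0 a * δ 0 b + n ≤ δ t a * δ t b := by
    intro n
    induction n with
    | zero => exact ⟨0, by simp⟩
    | succ n ih =>
      obtain ⟨t, ht⟩ := ih
      obtain ⟨t', htt', hne⟩ := hnz t
      refine ⟨t' + 1, ?_⟩
      have h1 := hmono t t' htt'
      have h2 : 1 ≤ δ t' (j t') ^ 2 := by
        have : δ t' (j t') ≤ -1 ∨ 1 ≤ δ t' (j t') := by omega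
        rcases this with h | h <;> nlinarith
      rw [hpot t']
      push_cast
      linarith
  obtain ⟨t, ht⟩ := hgrow ((δ 0 a * δ 0 b).natAbs + 1)
  have h := hmix t
  push_cast at ht
  linarith [neg_abs_le (δ 0 a * δ 0 b)]

/-! ## 2. Three chart letters -/

/-- The quadratic potential of the three-letter drift is negative on MIXED states. [folklore] -/
theorem pureCorner_potential_neg {x y z : ℤ} (hx : x ≤ -1) (hy : 1 ≤ y) :
    (x + y + z) ^ 2 - 2 * (x ^ 2 + y ^ 2 + z ^ 2) ≤ -1 := by
  by_cases hyz : 0 ≤ y + z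
  · nlinarith [sq_nonneg (y - z)]
  · nlinarith [sq_nonneg (x - z)]

/-- **PURE-CORNER DRIFT ON THREE LETTERS.**  A word `j` in three letters `a, b, c`, each occurring beyond every time; integer data
`δ t l` with `δ (t+1) (j t) = δ t (j t)` and `δ (t+1) l = δ t l + δ t (j t)` for `l ≠ j t`; `δ t a, δ t b, δ t c` bounded below.  Then from
some time on `δ t a, δ t b, δ t c ≥ 0`.  (Potential `(Σ δ)² − 2 Σ δ²`: it grows by `4 δ_{j t}²` per step and is `≤ −1` on mixed states;
all-nonpositive states with a negative entry crash through the lower bound; all-nonnegative states are absorbing.) [OURS]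
[cite: CossartJannsenSaito2020, Lemma 13.4] -/
theorem pureCorner_drift_three {j : ℕ → Fin 4} {a b c : Fin 4} (hab : a ≠ b) (hac : a ≠ c) (hbc : b ≠ c)
    (hj : ∀ t, j t = a ∨ j t = b ∨ j t = c) (ha : ∀ T, ∃ t, T ≤ t ∧ j t = a) (hb : ∀ T, ∃ t, T ≤ t ∧ j t = b)
    (hc : ∀ T, ∃ t, T ≤ t ∧ j t = c) {δ : ℕ → Fin 4 → ℤ} (hfix : ∀ t, δ (t + 1) (j t) = δ t (j t))
    (hadd : ∀ t l, l ≠ j t → δ (t + 1) l = δ t l + δ t (j t)) {B : ℤ}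
    (hB : ∀ t, B ≤ δ t a ∧ B ≤ δ t b ∧ B ≤ δ t c) :
    ∃ T, ∀ t, T ≤ t → 0 ≤ δ t a ∧ 0 ≤ δ t b ∧ 0 ≤ δ t c := by
  -- one-step formulas
  have step : ∀ t, (j t = a ∧ δ (t + 1) a = δ t a ∧ δ (t + 1) b = δ t b + δ t a ∧ δ (t + 1) c = δ t c + δ t a) ∨
      (j t = b ∧ δ (t + 1) b = δ t b ∧ δ (t + 1) a = δ t a + δ t b ∧ δ (t + 1) c = δ t c + δ t b) ∨
      (j t = c ∧ δ (t + 1) c = δ t c ∧ δ (t + 1) a = δ t a + δ t c ∧ δ (t + 1) b = δ t b + δ t c) := by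
    intro t
    rcases hj t with h | h | h
    · refine Or.inl ⟨h, ?_, ?_, ?_⟩
      · have := hfix t; rwa [h] at this
      · have := hadd t b (by rw [h]; exact hab.symm); rwa [h] at this
      · have := hadd t c (by rw [h]; exact hac.symm); rwa [h] at this
    · refine Or.inr (Or.inl ⟨h, ?_, ?_, ?_⟩)
      · have := hfix t; rwa [h] at this
      · have := hadd t a (by rw [h]; exact hab); rwa [h] at this
      · have := hadd t c (by rw [h]; exact hbc.symm); rwa [h] at this
    · refine Or.inr (Or.inr ⟨h, ?_, ?_, ?_⟩)
      · have := hfix t; rwa [h] at this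
      · have := hadd t a (by rw [h]; exact hac); rwa [h] at this
      · have := hadd t b (by rw [h]; exact hbc); rwa [h] at this
  -- the potential
  set H : ℕ → ℤ := fun t => (δ t a + δ t b + δ t c) ^ 2 - 2 * (δ t a ^ 2 + δ t b ^ 2 + δ t c ^ 2) with hHdef
  have hpot : ∀ t, H (t + 1) = H t + 4 * δ t (j t) ^ 2 := by
    intro t
    simp only [hHdef]
    rcases step t with ⟨h, h1, h2, h3⟩ | ⟨h, h1, h2, h3⟩ | ⟨h, h1, h2, h3⟩
    · rw [h1, h2, h3, h]; ring
    · rw [h1, h2, h3, h]; ring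
    · rw [h1, h2, h3, h]; ring
  have hmono : ∀ t T, t ≤ T → H t ≤ H T := by
    intro t T htT
    induction T, htT using Nat.le_induction with
    | base => exact le_refl _
    | succ T _ ih => exact ih.trans (by rw [hpot T]; nlinarith [sq_nonneg (δ T (j T))])
  -- escaped states are absorbing
  have hesc : ∀ t, 0 ≤ δ t a ∧ 0 ≤ δ t b ∧ 0 ≤ δ t c → ∀ T, t ≤ T → 0 ≤ δ T a ∧ 0 ≤ δ T b ∧ 0 ≤ δ T c := by
    intro t ht T htT
    induction T, htT using Nat.le_induction with
    | base => exact ht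
    | succ T _ ih =>
      obtain ⟨iha, ihb, ihc⟩ := ih
      rcases step T with ⟨-, h1, h2, h3⟩ | ⟨-, h1, h2, h3⟩ | ⟨-, h1, h2, h3⟩
      · rw [h1, h2, h3]; exact ⟨iha, add_nonneg ihb iha, add_nonneg ihc iha⟩
      · rw [h1, h2, h3]; exact ⟨add_nonneg iha ihb, ihb, add_nonneg ihc ihb⟩
      · rw [h1, h2, h3]; exact ⟨add_nonneg iha ihc, add_nonneg ihb ihc, ihc⟩
  by_cases hE : ∃ t, 0 ≤ δ t a ∧ 0 ≤ δ t b ∧ 0 ≤ δ t c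
  · obtain ⟨t, ht⟩ := hE
    exact ⟨t, hesc t ht⟩
  push Not at hE
  exfalso
  -- doomed states: all `≤ 0`; they persist coordinatewise
  have hdoom_persist : ∀ t, δ t a ≤ 0 ∧ δ t b ≤ 0 ∧ δ t c ≤ 0 →
      ∀ T, t ≤ T → δ T a ≤ δ t a ∧ δ T b ≤ δ t b ∧ δ T c ≤ δ t c := by
    intro t ht T htT
    induction T, htT using Nat.le_induction with
    | base => exact ⟨le_refl _, le_refl _, le_refl _⟩
    | succ T _ ih =>
      obtain ⟨iha, ihb, ihc⟩ := ih
      rcases step T with ⟨-, h1, h2, h3⟩ | ⟨-, h1, h2, h3⟩ | ⟨-, h1, h2, h3⟩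
      · rw [h1, h2, h3]; exact ⟨iha, by linarith [ht.1], by linarith [ht.1]⟩
      · rw [h1, h2, h3]; exact ⟨by linarith [ht.2.1], ihb, by linarith [ht.2.1]⟩
      · rw [h1, h2, h3]; exact ⟨by linarith [ht.2.2], by linarith [ht.2.2], ihc⟩
  by_cases hD : ∃ t, δ t a ≤ 0 ∧ δ t b ≤ 0 ∧ δ t c ≤ 0
  · obtain ⟨t₀, ht₀⟩ := hD
    -- one of them is `≤ −1` (not escaped)
    have hneg : δ t₀ a ≤ -1 ∨ δ t₀ b ≤ -1 ∨ δ t₀ c ≤ -1 := by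
      have h := hE t₀
      by_contra hcon
      push Not at hcon
      exact absurd (h (by omega) (by omega)) (by omega)
    -- after the negative letter is charted, all three are `≤ −1`
    obtain ⟨t₁, hall⟩ : ∃ t₁, δ t₁ a ≤ -1 ∧ δ t₁ b ≤ -1 ∧ δ t₁ c ≤ -1 := by
      rcases hneg with hn | hn | hn
      · obtain ⟨t, ht, hjt⟩ := ha t₀
        have hp := hdoom_persist t₀ ht₀ t ht
        rcases step t with ⟨-, h1, h2, h3⟩ | ⟨h, -⟩ | ⟨h, -⟩
        · exact ⟨t + 1, by rw [h1]; linarith [hp.1], by rw [h2]; linarith [hp.1, hp.2.1, ht₀.2.1],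
            by rw [h3]; linarith [hp.1, hp.2.2, ht₀.2.2]⟩
        · exact absurd (hjt.symm.trans h) hab
        · exact absurd (hjt.symm.trans h) hac
      · obtain ⟨t, ht, hjt⟩ := hb t₀
        have hp := hdoom_persist t₀ ht₀ t ht
        rcases step t with ⟨h, -⟩ | ⟨-, h1, h2, h3⟩ | ⟨h, -⟩
        · exact absurd (hjt.symm.trans h) hab.symm
        · exact ⟨t + 1, by rw [h2]; linarith [hp.1, hp.2.1, ht₀.1], by rw [h1]; linarith [hp.2.1],
            by rw [h3]; linarith [hp.2.1, hp.2.2, ht₀.2.2]⟩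
        · exact absurd (hjt.symm.trans h) hbc
      · obtain ⟨t, ht, hjt⟩ := hc t₀
        have hp := hdoom_persist t₀ ht₀ t ht
        rcases step t with ⟨h, -⟩ | ⟨h, -⟩ | ⟨-, h1, h2, h3⟩
        · exact absurd (hjt.symm.trans h) hac.symm
        · exact absurd (hjt.symm.trans h) hbc.symm
        · exact ⟨t + 1, by rw [h2]; linarith [hp.1, hp.2.2, ht₀.1], by rw [h3]; linarith [hp.2.1, hp.2.2, ht₀.2.1],
            by rw [h1]; linarith [hp.2.2]⟩
    -- from `t₁` on the sum drops by at least `2` each step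
    have hdrop : ∀ n : ℕ, δ (t₁ + n) a + δ (t₁ + n) b + δ (t₁ + n) c ≤ δ t₁ a + δ t₁ b + δ t₁ c - 2 * n ∧
        δ (t₁ + n) a ≤ -1 ∧ δ (t₁ + n) b ≤ -1 ∧ δ (t₁ + n) c ≤ -1 := by
      intro n
      induction n with
      | zero => simpa using hall
      | succ n ih =>
        obtain ⟨ihs, iha, ihb, ihc⟩ := ih
        rw [show t₁ + (n + 1) = t₁ + n + 1 by ring]
        rcases step (t₁ + n) with ⟨-, h1, h2, h3⟩ | ⟨-, h1, h2, h3⟩ | ⟨-, h1, h2, h3⟩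
        · rw [h1, h2, h3]; push_cast
          exact ⟨by linarith, iha, by linarith, by linarith⟩
        · rw [h1, h2, h3]; push_cast
          exact ⟨by linarith, by linarith, ihb, by linarith⟩
        · rw [h1, h2, h3]; push_cast
          exact ⟨by linarith, by linarith, by linarith, ihc⟩
    obtain ⟨n, hn⟩ : ∃ n : ℕ, δ t₁ a + δ t₁ b + δ t₁ c - 3 * B < 2 * n :=
      ⟨(δ t₁ a + δ t₁ b + δ t₁ c - 3 * B).natAbs + 1, by
        push_cast
        linarith [le_abs_self (δ t₁ a + δ t₁ b + δ t₁ c - 3 * B), abs_nonneg (δ t₁ a + δ t₁ b + δ t₁ c - 3 * B)]⟩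
    have h1 := (hdrop n).1
    have h2 := hB (t₁ + n)
    linarith [h2.1, h2.2.1, h2.2.2]
  push Not at hD
  -- every state is MIXED: the potential is `≤ −1` for ever, yet it grows without bound
  have hmix : ∀ t, H t ≤ -1 := by
    intro t
    have h1 := hE t
    have h2 := hD t
    -- some coordinate `≤ −1`, some `≥ 1`
    have hneg : δ t a ≤ -1 ∨ δ t b ≤ -1 ∨ δ t c ≤ -1 := by
      by_contra hcon; push Not at hcon
      exact absurd (h1 (by omega) (by omega)) (by omega)
    have hpos : 1 ≤ δ t a ∨ 1 ≤ δ t b ∨ 1 ≤ δ t c := by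
      by_contra hcon; push Not at hcon
      exact absurd (h2 (by omega) (by omega)) (by omega)
    simp only [hHdef]
    rcases hneg with hn | hn | hn <;> rcases hpos with hq | hq | hq
    · omega
    · have := pureCorner_potential_neg (z := δ t c) hn hq; linarith
    · have := pureCorner_potential_neg (z := δ t b) hn hq; linarith
    · have := pureCorner_potential_neg (z := δ t c) hn hq; linarith
    · omega
    · have := pureCorner_potential_neg (z := δ t a) hn hq; linarith
    · have := pureCorner_potential_neg (z := δ t b) hn hq; linarith
    · have := pureCorner_potential_neg (z := δ t a) hn hq; linarith
    · omega
  -- non-zero charted values occur beyond every time (else the state freezes at an escaped one)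
  have hnz : ∀ T, ∃ t, T ≤ t ∧ δ t (j t) ≠ 0 := by
    intro T
    by_contra hno
    push Not at hno
    have hconst : ∀ t, T ≤ t → δ t a = δ T a ∧ δ t b = δ T b ∧ δ t c = δ T c := by
      intro t ht
      induction t, ht using Nat.le_induction with
      | base => exact ⟨rfl, rfl, rfl⟩
      | succ t ht ih =>
        have h0 := hno t ht
        rcases step t with ⟨h, h1, h2, h3⟩ | ⟨h, h1, h2, h3⟩ | ⟨h, h1, h2, h3⟩
        · have h0' : δ t a = 0 := by rw [← h]; exact h0
          exact ⟨by rw [h1]; exact ih.1, by rw [h2, h0', add_zero]; exact ih.2.1, by rw [h3, h0', add_zero]; exact ih.2.2⟩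
        · have h0' : δ t b = 0 := by rw [← h]; exact h0
          exact ⟨by rw [h2, h0', add_zero]; exact ih.1, by rw [h1]; exact ih.2.1, by rw [h3, h0', add_zero]; exact ih.2.2⟩
        · have h0' : δ t c = 0 := by rw [← h]; exact h0
          exact ⟨by rw [h2, h0', add_zero]; exact ih.1, by rw [h3, h0', add_zero]; exact ih.2.1, by rw [h1]; exact ih.2.2⟩
    obtain ⟨ta, hta, hja⟩ := ha T
    obtain ⟨tb, htb, hjb⟩ := hb T
    obtain ⟨tc, htc, hjc⟩ := hc T
    have hza : δ T a = 0 := by rw [← (hconst ta hta).1, ← hja]; exact hno ta hta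
    have hzb : δ T b = 0 := by rw [← (hconst tb htb).2.1, ← hjb]; exact hno tb htb
    have hzc : δ T c = 0 := by rw [← (hconst tc htc).2.2, ← hjc]; exact hno tc htc
    have h := hE T (by rw [hza]) (by rw [hzb])
    rw [hzc] at h
    exact lt_irrefl _ h
  have hgrow : ∀ n : ℕ, ∃ t, H 0 + n ≤ H t := by
    intro n
    induction n with
    | zero => exact ⟨0, by simp⟩
    | succ n ih =>
      obtain ⟨t, ht⟩ := ih
      obtain ⟨t', htt', hne⟩ := hnz t
      refine ⟨t' + 1, ?_⟩
      have h1 := hmono t t' htt'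
      have h2 : 1 ≤ δ t' (j t') ^ 2 := by
        have : δ t' (j t') ≤ -1 ∨ 1 ≤ δ t' (j t') := by omega
        rcases this with h | h <;> nlinarith
      rw [hpot t']
      push_cast
      linarith
  obtain ⟨t, ht⟩ := hgrow ((H 0).natAbs + 1)
  have h := hmix t
  push_cast at ht
  linarith [neg_abs_le (H 0)]

end ResCone

end Summit.ResolutionOfSingularities.ResolutionOfSingularities.Theorems.PIDim4
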